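import Literature.Analysis.SpecialFunctions.HypergeometricQuadraticGaussODE
import Mathlib.Analysis.SpecialFunctions.Pow.Continuity
import Mathlib.Tactic.Linarith
import Mathlib.Tactic.Positivity
import Mathlib.Tactic.FieldSimp
import Mathlib.Tactic.Ring
import Mathlib.Tactic.LinearCombination
import HarnessLib

/-!
# Gauss's quadratic transformation `₂F₁(a,b;2b;4x/(1+x)²) = (1+x)^{2a} ₂F₁(a, a−b+½; b+½; x²)` (real, `a ≥ 0`, `b > 0`, `0 < x < 1`)

M. Swathi, A. K. Rathie, R. B. Paris, arXiv:1411.5262 (2014), §1 eq. (1.1): «(1+x)^{-2a} ₂F₁(a, b; 2b; 4x/(1+x)²) =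
₂F₁(a, a−b+½; b+½; x²) valid when |x| < 1 and |4x/(1+x)²| < 1 and provided 2b is neither zero nor a negative integer» — «the
one originally obtained by Gauss (see, for example, [AAR])»; §2 derives it «by Rainville's method»: both sides solve the `x`-form of the hypergeometric equation (2.1) (the unnumbered display following (2.1), with `c = 2b`, `z = 4x/(1+x)²`),
and a Frobenius argument at `x = 0` identifies them.

This file (part 2 of 2) proves the transformation for Mathlib's REAL `ordinaryHypergeometric` in the range
**`0 ≤ a`, `0 < b`, `0 < x < 1`**, with the Frobenius step replaced by ABEL'S IDENTITY (part 1,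
`HypergeometricQuadraticGaussODE`): `Z = ω·(W·W₂' − W'·W₂)` is constant on `(0,1)` and tends to `0` at `0⁺` (`x^{2b} → 0`, every
other factor has a finite limit: `W, W₂ → 1`, `W', W₂' → 2a`), so the Wronskian vanishes; `W = ₂F₁(a,b;2b;·) > 0` on `[0,1)` when
`a ≥ 0`, `b > 0` (non-negative coefficients, constant term `1`), so `W₂/W` has zero derivative on `(0,1)` and equals its limit `1`
at `0⁺`.

* (private helper `ordinaryHypergeometric_pos_of_nonneg` — `₂F₁(a,b;c;x) > 0` for `a, b ≥ 0`, `c > 0`, `0 ≤ x < 1`;)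
* **`ordinaryHypergeometric_gauss_quadratic`** — `₂F₁(a,b;2b;4x/(1+x)²) = (1+x)^{2a}·₂F₁(a, a−b+½; b+½; x²)`;
* `ordinaryHypergeometric_gauss_quadratic'` — the printed form `(1+x)^{−2a}·₂F₁(a,b;2b;4x/(1+x)²) = ₂F₁(a, a−b+½; b+½; x²)`.

Why `a ≥ 0`: the identification divides by `W`, whose positivity on `(0,1)` is what non-negative coefficients give; for `a < 0`
(e.g. terminating `₂F₁(−n,b;2b;·)`, which has zeros in `(0,1)`) the identity still holds (SRP/Rainville) but needs uniqueness for
the regular linear equation on `(0,1)` instead — NOT formalised here. The special case `a = b = h` (Hogervorst–Rychkov's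
`ρ`-series of the 2D chiral block) was landed earlier, independently, as
`Summit.CriticalPhenomena.Ising3D.Control2D.ordinaryHypergeometric_quadratic`; it is not restated here.

NOT claimed: `a < 0`; `b ≤ 0` (`2b ∈ −ℕ` is excluded by the source too); `x ≤ 0`, `x ≥ 1`, `|x| = 1`; complex `x` / the
statement on `{|x| < 1} ∩ {|4x/(1+x)²| < 1}` in `ℂ`; the contiguous transformations (1.2)–(1.3) of the source; Kummer's and the
other quadratic transformations; connection formulae.

## References
* [SwathiRathieParis2014] M. Swathi, A. K. Rathie, R. B. Paris, arXiv:1411.5262, §1 eq. (1.1), §2.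
* [AndrewsAskeyRoy1999] G. E. Andrews, R. Askey, R. Roy, *Special Functions*, CUP 1999, §3.1.
-/

noncomputable section

open Set Filter Topology

namespace Literature.Analysis.SpecialFunctions.Hypergeometric

open Literature.NumberTheory.Automorphic.LegendreP (hasDerivAt_ordinaryHypergeometric hasSum_ordinaryHypergeometric)

/-- `₂F₁(a,b;c;x) > 0` for `a, b ≥ 0`, `c > 0`, `0 ≤ x < 1`: every coefficient `(a)_n(b)_n/(n!(c)_n)` is `≥ 0` and the constant
term is `1` (the real series `hasSum_ordinaryHypergeometric` of the tree). Not a duplicate of the tree's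
`Summit.CriticalPhenomena.PercolationContinuityZ3.…KummerPartner.hyperg_pos` (hypotheses `0 < b < c`, any `a`, via Euler's
integral): here `a, b ≥ 0` with `c > 0` arbitrary, by termwise non-negativity — the ranges overlap but neither contains the other.
A private helper (an elementary consequence of the series, not a statement of the source). [folklore] -/
private theorem ordinaryHypergeometric_pos_of_nonneg {a b c x : ℝ} (ha : 0 ≤ a) (hb : 0 ≤ b) (hc : 0 < c) (hx0 : 0 ≤ x)
    (hx1 : x < 1) : 0 < ordinaryHypergeometric a b c x := by
  have hx : |x| < 1 := by rw [abs_of_nonneg hx0]; exact hx1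
  have hs := hasSum_ordinaryHypergeometric a b c hx
  have hP : ∀ (n : ℕ) {s : ℝ}, 0 ≤ s → 0 ≤ (ascPochhammer ℝ n).eval s := by
    intro n s hs0
    induction n with
    | zero => simp
    | succ n ih => rw [ascPochhammer_succ_eval]; exact mul_nonneg ih (by positivity)
  have hcoef : ∀ n, 0 ≤ ordinaryHypergeometricCoefficient a b c n := by
    intro n
    rw [ordinaryHypergeometricCoefficient]
    have h1 := hP n ha
    have h2 := hP n hb
    have h3 : 0 < (ascPochhammer ℝ n).eval c := ascPochhammer_pos n c hc
    positivity
  have h0 : ordinaryHypergeometricCoefficient a b c 0 * x ^ 0 = 1 := by simp [ordinaryHypergeometricCoefficient]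
  have h1 := sum_le_hasSum {0} (fun m _ => mul_nonneg (hcoef m) (pow_nonneg hx0 m)) hs
  simp only [Finset.sum_singleton, h0] at h1
  linarith

/-- **Gauss's quadratic transformation** (real form, `0 ≤ a`, `0 < b`, `0 < x < 1`):
`₂F₁(a, b; 2b; 4x/(1+x)²) = (1+x)^{2a} · ₂F₁(a, a−b+½; b+½; x²)`. PROOF (Rainville's differential-equation route, the Frobenius
step replaced by Abel's identity): both sides `W`, `W₂` solve the `x`-form of (2.1) on `(0,1)` (`gaussQuadraticLeft_ode`, `gaussQuadraticRight_ode`),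
so `Z = x^{2b}(1−x)^{1+2a−2b}(1+x)^{1−2a−2b}·(W·W₂' − W'·W₂)` is constant there (`hasDerivAt_gaussQuadratic_wronskian`); as
`x → 0⁺` the factor `x^{2b}` tends to `0` BECAUSE `b > 0`, while the other factors have finite limits — `(1∓x)^{…} → 1`,
`W → ₂F₁(a,b;2b;0) = 1`, `W₂ → 1^{2a}·₂F₁(…;0) = 1`, `W' = (ab/(2b))₂F₁(a+1,b+1;2b+1;z)·z' → (ab/(2b))·4 = 2a` and
`W₂' → 2a·1 + 1·0 = 2a` (each piece is continuous at `0`) — so `Z → 0`, hence `Z ≡ 0` and the Wronskian vanishes on `(0,1)`;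
`W > 0` there BECAUSE `a ≥ 0`, `b > 0` (`ordinaryHypergeometric_pos_of_nonneg`), so `W₂/W` has zero derivative on `(0,1)` and
equals its limit `W₂(0)/W(0) = 1` at `0⁺`. [cite: SwathiRathieParis2014, §1 eq. (1.1)] -/
theorem ordinaryHypergeometric_gauss_quadratic {a b : ℝ} (ha : 0 ≤ a) (hb : 0 < b) {x : ℝ} (hx : x ∈ Ioo (0 : ℝ) 1) :
    ordinaryHypergeometric a b (2 * b) (4 * x / (1 + x) ^ 2) =
      (1 + x) ^ (2 * a) * ordinaryHypergeometric a (a - b + 1 / 2) (b + 1 / 2) (x ^ 2) := by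
  set Yf : ℝ → ℝ := fun r => ordinaryHypergeometric a b (2 * b) (4 * r / (1 + r) ^ 2) with hYf
  set Vf : ℝ → ℝ := fun r => (1 + r) ^ (2 * a) * ordinaryHypergeometric a (a - b + 1 / 2) (b + 1 / 2) (r ^ 2)
    with hVf
  -- explicit first derivatives (continuous at `0`)
  set Y₁ : ℝ → ℝ := fun r => a * b / (2 * b) *
    ordinaryHypergeometric (a + 1) (b + 1) (2 * b + 1) (4 * r / (1 + r) ^ 2) * (4 * (1 - r) / (1 + r) ^ 3) with hY₁
  set V₁ : ℝ → ℝ := fun r => 2 * a * (1 + r) ^ (2 * a - 1) * ordinaryHypergeometric a (a - b + 1 / 2) (b + 1 / 2) (r ^ 2) +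
    (1 + r) ^ (2 * a) * (a * (a - b + 1 / 2) / (b + 1 / 2) *
      ordinaryHypergeometric (a + 1) (a - b + 1 / 2 + 1) (b + 1 / 2 + 1) (r ^ 2) * (2 * r)) with hV₁
  have hdY : ∀ r ∈ Ioo (0 : ℝ) 1, deriv Yf r = Y₁ r := fun r hr => (gaussQuadraticLeft_deriv_data a b hr).1.deriv
  have hdV : ∀ r ∈ Ioo (0 : ℝ) 1, deriv Vf r = V₁ r := fun r hr => (gaussQuadraticRight_deriv_data a b hr).1.deriv
  -- `Z` is constant on `(0,1)`
  set Z : ℝ → ℝ := fun r => r ^ (2 * b) * (1 - r) ^ (1 + 2 * a - 2 * b) * (1 + r) ^ (1 - 2 * a - 2 * b) *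
    (Yf r * deriv Vf r - deriv Yf r * Vf r) with hZ
  have hZc : ∀ r ∈ Ioo (0 : ℝ) 1, Z r = Z (1 / 2) := fun r hr =>
    IsOpen.is_const_of_deriv_eq_zero isOpen_Ioo (convex_Ioo (0 : ℝ) 1).isPreconnected
      (fun y hy => (hasDerivAt_gaussQuadratic_wronskian (a := a) hb hy).differentiableAt.differentiableWithinAt)
      (fun y hy => (hasDerivAt_gaussQuadratic_wronskian (a := a) hb hy).deriv) hr ⟨by norm_num, by norm_num⟩
  -- continuity at `0` of the pieces
  have hz0 : ContinuousAt (fun r : ℝ => 4 * r / (1 + r) ^ 2) 0 :=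
    ((continuousAt_const.mul continuousAt_id).div ((continuousAt_const.add continuousAt_id).pow 2)
      (by norm_num))
  have hF0 : ∀ a' b' c' : ℝ, ContinuousAt (fun r : ℝ => ordinaryHypergeometric a' b' c' (4 * r / (1 + r) ^ 2)) 0 := by
    intro a' b' c'
    have hc : ContinuousAt (ordinaryHypergeometric a' b' c') (4 * (0 : ℝ) / (1 + 0) ^ 2) :=
      (hasDerivAt_ordinaryHypergeometric (a := a') (b := b') (c := c') (by norm_num)).continuousAt
    exact ContinuousAt.comp (g := ordinaryHypergeometric a' b' c') hc hz0
  have hG0 : ∀ a' b' c' : ℝ, ContinuousAt (fun r : ℝ => ordinaryHypergeometric a' b' c' (r ^ 2)) 0 := by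
    intro a' b' c'
    have hc : ContinuousAt (ordinaryHypergeometric a' b' c') ((0 : ℝ) ^ 2) :=
      (hasDerivAt_ordinaryHypergeometric (a := a') (b := b') (c := c') (by norm_num)).continuousAt
    exact ContinuousAt.comp (g := ordinaryHypergeometric a' b' c') hc (continuousAt_id.pow 2)
  have hP0 : ∀ p : ℝ, ContinuousAt (fun r : ℝ => (1 + r) ^ p) 0 := fun p =>
    (continuousAt_const.add continuousAt_id).rpow_const (Or.inl (by norm_num))
  have hM0 : ∀ p : ℝ, ContinuousAt (fun r : ℝ => (1 - r) ^ p) 0 := fun p =>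
    (continuousAt_const.sub continuousAt_id).rpow_const (Or.inl (by norm_num))
  have hYc : ContinuousAt Yf 0 := hF0 a b (2 * b)
  have hVc : ContinuousAt Vf 0 := (hP0 (2 * a)).mul (hG0 a (a - b + 1 / 2) (b + 1 / 2))
  have hY₁c : ContinuousAt Y₁ 0 :=
    ((continuousAt_const.mul (hF0 (a + 1) (b + 1) (2 * b + 1))).mul
      ((continuousAt_const.mul (continuousAt_const.sub continuousAt_id)).div
        ((continuousAt_const.add continuousAt_id).pow 3) (by norm_num)))
  have hV₁c : ContinuousAt V₁ 0 :=
    ((continuousAt_const.mul (hP0 (2 * a - 1))).mul (hG0 a (a - b + 1 / 2) (b + 1 / 2))).add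
      ((hP0 (2 * a)).mul ((continuousAt_const.mul (hG0 (a + 1) (a - b + 1 / 2 + 1) (b + 1 / 2 + 1))).mul
        (continuousAt_const.mul continuousAt_id)))
  -- `Z → 0` at `0⁺`
  have hIoo : Ioo (0 : ℝ) 1 ∈ 𝓝[>] (0 : ℝ) := Ioo_mem_nhdsGT (by norm_num)
  have hM : Tendsto (fun r => (1 - r) ^ (1 + 2 * a - 2 * b) * (1 + r) ^ (1 - 2 * a - 2 * b) *
      (Yf r * deriv Vf r - deriv Yf r * Vf r)) (𝓝[>] 0)
      (𝓝 ((1 - 0) ^ (1 + 2 * a - 2 * b) * (1 + 0) ^ (1 - 2 * a - 2 * b) * (Yf 0 * V₁ 0 - Y₁ 0 * Vf 0))) := by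
    have hc : ContinuousAt (fun r => (1 - r) ^ (1 + 2 * a - 2 * b) * (1 + r) ^ (1 - 2 * a - 2 * b) *
        (Yf r * V₁ r - Y₁ r * Vf r)) 0 :=
      ((hM0 (1 + 2 * a - 2 * b)).mul (hP0 (1 - 2 * a - 2 * b))).mul ((hYc.mul hV₁c).sub (hY₁c.mul hVc))
    refine (hc.tendsto.mono_left nhdsWithin_le_nhds).congr' ?_
    filter_upwards [hIoo] with r hr
    simp only [hdY r hr, hdV r hr]
  have hρpow : Tendsto (fun r : ℝ => r ^ (2 * b)) (𝓝[>] 0) (𝓝 0) := by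
    have hc := (Real.continuousAt_rpow_const 0 (2 * b) (Or.inr (by positivity))).tendsto
    rw [Real.zero_rpow (by positivity)] at hc
    exact hc.mono_left nhdsWithin_le_nhds
  have hZ0 : Tendsto Z (𝓝[>] 0) (𝓝 0) := by
    have h := hρpow.mul hM
    rw [zero_mul] at h
    refine h.congr' (Eventually.of_forall fun r => ?_)
    simp only [hZ]; ring
  have hZhalf : Z (1 / 2) = 0 := by
    have hlim : Tendsto Z (𝓝[>] 0) (𝓝 (Z (1 / 2))) := by
      refine tendsto_const_nhds.congr' ?_
      filter_upwards [hIoo] with r hr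
      exact (hZc r hr).symm
    exact tendsto_nhds_unique hlim hZ0
  -- the Wronskian vanishes on `(0,1)`
  have hW : ∀ r ∈ Ioo (0 : ℝ) 1, Yf r * deriv Vf r - deriv Yf r * Vf r = 0 := by
    intro r hr
    have hz := hZc r hr
    rw [hZhalf] at hz
    have hw : r ^ (2 * b) * (1 - r) ^ (1 + 2 * a - 2 * b) * (1 + r) ^ (1 - 2 * a - 2 * b) ≠ 0 := by
      have h1 : 0 < r ^ (2 * b) := Real.rpow_pos_of_pos hr.1 _
      have h2 : 0 < (1 - r) ^ (1 + 2 * a - 2 * b) := Real.rpow_pos_of_pos (by linarith [hr.2]) _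
      have h3 : 0 < (1 + r) ^ (1 - 2 * a - 2 * b) := Real.rpow_pos_of_pos (by linarith [hr.1]) _
      positivity
    exact (mul_eq_zero.mp hz).resolve_left hw
  -- positivity of `Yf` on `[0,1)`
  have hYpos : ∀ r, 0 ≤ r → r < 1 → 0 < Yf r := by
    intro r hr0 hr1
    have hzI : 0 ≤ 4 * r / (1 + r) ^ 2 ∧ 4 * r / (1 + r) ^ 2 < 1 := by
      have h1 : 0 < (1 + r) ^ 2 := by nlinarith
      refine ⟨div_nonneg (by linarith) h1.le, ?_⟩
      rw [div_lt_one h1]; nlinarith [sq_nonneg (1 - r)]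
    exact ordinaryHypergeometric_pos_of_nonneg ha hb.le (by linarith) hzI.1 hzI.2
  -- the ratio `Vf/Yf` is constant on `(0,1)`
  have hquot : ∀ r ∈ Ioo (0 : ℝ) 1, HasDerivAt (fun y => Vf y / Yf y) 0 r := by
    intro r hr
    obtain ⟨hY, -⟩ := gaussQuadraticLeft_deriv_data a b hr
    obtain ⟨hV, -⟩ := gaussQuadraticRight_deriv_data a b hr
    have hYd : HasDerivAt Yf (deriv Yf r) r := hY.differentiableAt.hasDerivAt
    have hVd : HasDerivAt Vf (deriv Vf r) r := hV.differentiableAt.hasDerivAt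
    refine ((hVd.div hYd (hYpos r hr.1.le hr.2).ne')).congr_deriv ?_
    rw [div_eq_zero_iff]
    left
    linear_combination hW r hr
  obtain ⟨c, hc⟩ := IsOpen.exists_is_const_of_deriv_eq_zero (f := fun y => Vf y / Yf y)
    isOpen_Ioo (convex_Ioo (0 : ℝ) 1).isPreconnected
    (fun y hy => (hquot y hy).differentiableAt.differentiableWithinAt)
    (fun y hy => (hquot y hy).deriv)
  -- the constant is `1`: limit at `0⁺`
  have hY0 : Yf 0 = 1 := by simp [hYf]
  have hV0 : Vf 0 = 1 := by simp [hVf]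
  have hc1 : c = 1 := by
    have hlim : Tendsto (fun y => Vf y / Yf y) (𝓝[>] 0) (𝓝 (Vf 0 / Yf 0)) :=
      ((hVc.div hYc (by rw [hY0]; norm_num)).tendsto).mono_left nhdsWithin_le_nhds
    rw [hY0, hV0, div_one] at hlim
    have hlim' : Tendsto (fun y => Vf y / Yf y) (𝓝[>] 0) (𝓝 c) := by
      refine tendsto_const_nhds.congr' ?_
      filter_upwards [hIoo] with y hy
      exact (hc y hy).symm
    exact tendsto_nhds_unique hlim' hlim
  have h := hc x hx
  rw [hc1, div_eq_one_iff_eq (hYpos x hx.1.le hx.2).ne'] at h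
  simpa [hYf, hVf] using h.symm

/-- **Gauss's quadratic transformation in the printed form** (arXiv:1411.5262 eq. (1.1)), real `0 ≤ a`, `0 < b`, `0 < x < 1`:
`(1+x)^{−2a} · ₂F₁(a, b; 2b; 4x/(1+x)²) = ₂F₁(a, a−b+½; b+½; x²)`. [cite: SwathiRathieParis2014, §1 eq. (1.1)] -/
theorem ordinaryHypergeometric_gauss_quadratic' {a b : ℝ} (ha : 0 ≤ a) (hb : 0 < b) {x : ℝ} (hx : x ∈ Ioo (0 : ℝ) 1) :
    (1 + x) ^ (-(2 * a)) * ordinaryHypergeometric a b (2 * b) (4 * x / (1 + x) ^ 2) =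
      ordinaryHypergeometric a (a - b + 1 / 2) (b + 1 / 2) (x ^ 2) := by
  have h1 : (0 : ℝ) < 1 + x := by linarith [hx.1]
  rw [ordinaryHypergeometric_gauss_quadratic ha hb hx, ← mul_assoc, ← Real.rpow_add h1, neg_add_cancel,
    Real.rpow_zero, one_mul]

end Literature.Analysis.SpecialFunctions.Hypergeometric

end
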